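import Summits.BirchSwinnertonDyer.BirchSwinnertonDyer.Theorems.GenusKolyvaginAtTwoHeegnerValuationLedger
import Summits.BirchSwinnertonDyer.BirchSwinnertonDyer.Theorems.GenusKolyvaginAtTwoShaConsistencyLawFreeCells
import Summits.BirchSwinnertonDyer.BirchSwinnertonDyer.Theorems.GenusKolyvaginAtTwoPowDvdShaCardAtTwoRTGenusBudgetPrimeDisc
import HarnessLib

/-!
# Route `GenusKolyvaginAtTwo`, crux K₄⁻ `K4Neg` (stmt-BirchSwinnertonDyer-31526), LINE 32 «frame_rigidity⁻»: stub F2L⁻ `stub_twoFrameLedger` IS A THEOREM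

LEAD seat `bsd-line-gk2-p1` g26 (cell `bsd-f1-sign2`), `--supports stmt-BirchSwinnertonDyer-31526`.  THEOREMS ONLY (no definition, no named fact,
no `sorry`).  **BSD is NOT proved by this file; K4Neg is NOT proved; no item is closed.**  CONDITIONAL on the route's four PRINT items
(`GrossZagierAllLevels`, `MultPublishedInputsAtTwo`, `EntireLFunctionRat`, `MilneAnyModel`), displayed as binders exactly as in the stub.

* `k4Neg_frameLedger_eq` — ONE frame: on the K₄⁻ cell (`Δ < 0`, `#Sel₂(E) = 4`, admissible prime frame `K = ℚ(√−ℓ₀)` with `2` split, odd-Manin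
  `Dt`, `2^(M₀) ∥ P(1)`, `Sel₂`-minimal rank-one twin `Wd`): `#Ш_an(E) = qW ∈ ℚ` and **`2·M₀ = ord₂ qW + ord₂ qd`** for `#Ш_an(Wd) = qd` — the Heegner
  valuation ledger `ValuationLedger.two_mul_depth_eq_padicValRat_add` + `Ш(Wd/ℚ)[2^∞] = 0` (rank one, `#Sel₂ = 2`) + gk2-p4 g29's cell law
  `ShaCores.natCard_shaPrimary_baseChange_eq_rat_of_kFourNeg_cell`.  NOTE: the twin's Tamagawa budget `ord₂ C(Wd) ≤ 1` is NOT used — the exact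
  ledger has NO Tamagawa term.
* `k4Neg_twoFrameLedger_tFree` — two frames: **`2·M₀ − 2·M₁ = ord₂ q₀ − ord₂ q₁`** (the common `ord₂ #Ш_an(E)` cancels) — the t-free form.
* `k4Neg_twoFrameLedger` — **LINE 32 stub F2L⁻ `stub_twoFrameLedger` VERBATIM** (`2·M₀ − 2·M₁ = (ord₂ q₀ + ord₂ C(Wd₀)) − (ord₂ q₁ + ord₂ C(Wd₁))`):
  the t-free form PLUS `ord₂ C(Wd₀) = ord₂ C(Wd₁) = 1`, which holds at every prime frame `|d_K| = ℓ` of a `Δ < 0` curve with odd `C(E)` (gk2-p2 g17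
  `PlusDescent.padicValNat_two_tamagawaProduct_twin_eq_one_of_prime`: the genus budget is exactly one bit).  Pen: plug
  `stub_twoFrameLedger := …ValuationLedger.k4Neg_twoFrameLedger`; the card's «parity step» (`2(M₀−M₁) = t₀ − t₁`) is idle — `t₀ = t₁ = 1`.
READING: with F2L⁻ a theorem, LINE 32's open content is F1⁻ / F2T⁻ / F2Z⁻ / F4⁻ — unchanged; as on K₄⁺, F2⁻ «depth rigidity» ⟺ «`ord₂ #Ш_an(E^(−ℓ))`
constant over the cell's admissible `ℓ`» EXACTLY, mod PRINT.

References: [GrossZagier1986] V §2 (2.2); [Milne1972ArithmeticAV] §1 Thm. 1; [Kramer1981] Thm. 1, Prop. 7; [Miller2011LMS] Def. 1.1; [SilvermanAEC2009] Thm. X.4.2.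
-/

set_option autoImplicit false
set_option linter.dupNamespace false -- `Summit.<P>.<Sub>` repeats `BirchSwinnertonDyer` (D-0017)

noncomputable section

open scoped Classical

namespace Summit.BirchSwinnertonDyer.BirchSwinnertonDyer.Theorems.GenusExact.ValuationLedger

open WeierstrassCurve NumberField IsDedekindDomain Field Literature.NumberTheory.EllipticCurves
  Literature.NumberTheory.GaloisRepresentations Literature.NumberTheory.EllipticCurves.ModularForms
  Literature.NumberTheory.EllipticCurves.RingClassField
  Summit.BirchSwinnertonDyer.BirchSwinnertonDyer.Theses.GenusKolyvaginAtTwo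

/-- **THE K₄⁻ FRAME LEDGER (one frame)**: on the K₄⁻ cell with an admissible prime frame `K = ℚ(√−ℓ₀)` (`2` split), odd-Manin `Dt`, `2^(M₀) ∥ P(1)`
(any `M₀`), the `Sel₂`-minimal rank-one twin `Wd` and `#Ш_an(Wd) = qd ∈ ℚ`: `#Ш_an(E) = qW ∈ ℚ` and **`2·M₀ = ord₂ qW + ord₂ qd`**.  Heegner valuation
ledger + `Ш(Wd)[2^∞] = 0` + the K₄⁻ cell law `#Ш(E_K)[2^∞] = #Ш(E/ℚ)[2^∞]`; no Tamagawa budget is used.  CONDITIONAL on the four print items;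
BSD / K4Neg NOT proved. [cite: GrossZagier1986, V §2 (2.2)] [cite: Milne1972ArithmeticAV, §1 Thm. 1] [cite: Kramer1981, Thm. 1, Prop. 7]
[cite: Miller2011LMS, Def. 1.1] -/
theorem k4Neg_frameLedger_eq (hGZ : GrossZagierAllLevels) (hGZK : MultPublishedInputsAtTwo) (hL : EntireLFunctionRat) (hMi : MilneAnyModel)
    (W : WeierstrassCurve ℚ) [W.IsElliptic] [W.IsGloballyMinimal] [NeZero (W.conductorNorm ℤ)]
    (hr0 : W.analyticRank = 0) (hρ : ∀ n : ℕ, 0 < n → W.HasSurjectiveModNGaloisRep ((2 : ℤ) ^ n))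
    (hT : Odd W.tamagawaProduct) (hneg : W.Δ < 0) (h4 : Nat.card (W.selmerGroup 2) = 4)
    (Dt : ModularParametrizationData W (W.conductorNorm ℤ)) (hc : Odd Dt.c)
    (K : Type) [Field K] [NumberField K] (hIQ : IsImaginaryQuadratic K) (hodd : Odd (NumberField.discr K))
    (h3 : NumberField.discr K ≠ -3) (hHe : SatisfiesHeegnerHypothesis (W.conductorNorm ℤ) K)
    (hsq1 : ¬ IsSquare ((NumberField.discr K : ℚ) * -|W.Δ|))
    (ℓ₀ : ℕ) (hℓ₀ : ℓ₀.Prime) (hdK : NumberField.discr K = -(ℓ₀ : ℤ))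
    (h2K : ((Ideal.span {(2 : ℤ)}).primesOver (𝓞 K)).ncard = 2)
    (β : ℤ) (ι : K →+* ℂ) (d₁ : KolyvaginHeegnerData Dt β ι 1) (hy : ¬ IsOfFinAddOrder d₁.derivedPoint)
    {M₀ : ℕ} (hdiv : ∃ Q : (W.baseChange (ringClassField K ι 1)).toAffine.Point, ((2 ^ M₀ : ℕ) : ℤ) • Q = d₁.derivedPoint)
    (hndiv : ¬ ∃ Q : (W.baseChange (ringClassField K ι 1)).toAffine.Point, ((2 ^ (M₀ + 1) : ℕ) : ℤ) • Q = d₁.derivedPoint)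
    (Wd : WeierstrassCurve ℚ) [Wd.IsElliptic] [Wd.IsGloballyMinimal]
    (hWd : ∃ C : VariableChange ℚ, C • W.quadraticTwist (NumberField.discr K : ℚ) = Wd)
    (hrd : Wd.analyticRank = 1) (hSel : Nat.card (Wd.selmerGroup 2) = 2)
    {qd : ℚ} (hqd : shaAn Wd = (qd : ℂ)) :
    ∃ qW : ℚ, shaAn W = (qW : ℂ) ∧ 2 * (M₀ : ℤ) = padicValRat 2 qW + padicValRat 2 qd := by
  haveI : Fact (Nat.Prime 2) := ⟨Nat.prime_two⟩
  haveI : Fact ℓ₀.Prime := ⟨hℓ₀⟩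
  have hρ2 : W.HasSurjectiveModNGaloisRep 2 := by simpa using hρ 1 one_pos
  have hrk0 : W.mordellWeilRank = 0 := (hGZK W (by rw [hr0]; exact zero_le_one)).1.trans hr0
  have hsq : ¬ IsSquare ((NumberField.discr K : ℚ) * W.Δ) := by rwa [abs_of_neg hneg, neg_neg] at hsq1
  obtain ⟨σ₀, hσ₀, -⟩ := exists_conj_of_isImaginaryQuadratic (K := K) hIQ
  have hrk : Wd.mordellWeilRank = 1 := (hGZK Wd (by rw [hrd])).1.trans hrd
  exact exists_two_mul_depth_eq_padicValRat_add hGZ hGZK hL hMi W hρ2 hT hr0 K hIQ hodd h3 hHe Dt hc β ι d₁ hdiv hndiv Wd hWd hrd hqd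
    (natCard_primaryComponent_sha_two_eq_one_of_rank_one Wd hrk hSel)
    (by
      intro _ _
      exact (ShaCores.natCard_shaPrimary_baseChange_eq_rat_of_kFourNeg_cell W K hneg hρ2 h4 hIQ hodd hHe h2K hdK Wd hWd hSel hσ₀ hr0 hsq
        Dt β ι d₁ hy hdiv hndiv hrk0).1)

/-- **THE K₄⁻ TWO-FRAME LEDGER, t-FREE FORM**: for `E = W` on the K₄⁻ cell with an odd-Manin `Dt` and two admissible prime frames with Heegner data
(depths `M₀`, `M₁`, ANY values) and their `Sel₂`-minimal rank-one twins with `#Ш_an(Wd_i) = q_i ∈ ℚ`: **`2·M₀ − 2·M₁ = ord₂ q₀ − ord₂ q₁`** — NO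
Tamagawa term (`k4Neg_frameLedger_eq` at both frames; the common `ord₂ #Ш_an(E)` cancels).  CONDITIONAL on the four print items; BSD / K4Neg NOT
proved. [cite: GrossZagier1986, V §2 (2.2)] [cite: Milne1972ArithmeticAV, §1 Thm. 1] [cite: Kramer1981, Thm. 1, Prop. 7] [cite: Miller2011LMS, Def. 1.1] -/
theorem k4Neg_twoFrameLedger_tFree (hGZ : GrossZagierAllLevels) (hGZK : MultPublishedInputsAtTwo) (hL : EntireLFunctionRat)
    (hMi : MilneAnyModel)
    (W : WeierstrassCurve ℚ) [W.IsElliptic] [W.IsGloballyMinimal] [NeZero (W.conductorNorm ℤ)]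
    (hr0 : W.analyticRank = 0) (hρ : ∀ n : ℕ, 0 < n → W.HasSurjectiveModNGaloisRep ((2 : ℤ) ^ n))
    (hT : Odd W.tamagawaProduct) (hneg : W.Δ < 0) (h4 : Nat.card (W.selmerGroup 2) = 4)
    (Dt : ModularParametrizationData W (W.conductorNorm ℤ)) (hc : Odd Dt.c)
    (K₀ : Type) [Field K₀] [NumberField K₀] (hIQ₀ : IsImaginaryQuadratic K₀) (hodd₀ : Odd (NumberField.discr K₀))
    (h3₀ : NumberField.discr K₀ ≠ -3) (hHe₀ : SatisfiesHeegnerHypothesis (W.conductorNorm ℤ) K₀)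
    (hsq1₀ : ¬ IsSquare ((NumberField.discr K₀ : ℚ) * -|W.Δ|))
    (ℓ₀ : ℕ) (hℓ₀ : ℓ₀.Prime) (hdK₀ : NumberField.discr K₀ = -(ℓ₀ : ℤ))
    (h2K₀ : ((Ideal.span {(2 : ℤ)}).primesOver (𝓞 K₀)).ncard = 2)
    (β₀ : ℤ) (ι₀ : K₀ →+* ℂ) (d₀ : KolyvaginHeegnerData Dt β₀ ι₀ 1) (hy₀ : ¬ IsOfFinAddOrder d₀.derivedPoint)
    {M₀ : ℕ} (hdiv₀ : ∃ Q : (W.baseChange (ringClassField K₀ ι₀ 1)).toAffine.Point, ((2 ^ M₀ : ℕ) : ℤ) • Q = d₀.derivedPoint)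
    (hndiv₀ : ¬ ∃ Q : (W.baseChange (ringClassField K₀ ι₀ 1)).toAffine.Point, ((2 ^ (M₀ + 1) : ℕ) : ℤ) • Q = d₀.derivedPoint)
    (Wd₀ : WeierstrassCurve ℚ) [Wd₀.IsElliptic] [Wd₀.IsGloballyMinimal]
    (hWd₀ : ∃ C : VariableChange ℚ, C • W.quadraticTwist (NumberField.discr K₀ : ℚ) = Wd₀)
    (hrd₀ : Wd₀.analyticRank = 1) (hSel₀ : Nat.card (Wd₀.selmerGroup 2) = 2)
    (K₁ : Type) [Field K₁] [NumberField K₁] (hIQ₁ : IsImaginaryQuadratic K₁) (hodd₁ : Odd (NumberField.discr K₁))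
    (h3₁ : NumberField.discr K₁ ≠ -3) (hHe₁ : SatisfiesHeegnerHypothesis (W.conductorNorm ℤ) K₁)
    (hsq1₁ : ¬ IsSquare ((NumberField.discr K₁ : ℚ) * -|W.Δ|))
    (ℓ₁ : ℕ) (hℓ₁ : ℓ₁.Prime) (hdK₁ : NumberField.discr K₁ = -(ℓ₁ : ℤ))
    (h2K₁ : ((Ideal.span {(2 : ℤ)}).primesOver (𝓞 K₁)).ncard = 2)
    (β₁ : ℤ) (ι₁ : K₁ →+* ℂ) (d₁ : KolyvaginHeegnerData Dt β₁ ι₁ 1) (hy₁ : ¬ IsOfFinAddOrder d₁.derivedPoint)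
    {M₁ : ℕ} (hdiv₁ : ∃ Q : (W.baseChange (ringClassField K₁ ι₁ 1)).toAffine.Point, ((2 ^ M₁ : ℕ) : ℤ) • Q = d₁.derivedPoint)
    (hndiv₁ : ¬ ∃ Q : (W.baseChange (ringClassField K₁ ι₁ 1)).toAffine.Point, ((2 ^ (M₁ + 1) : ℕ) : ℤ) • Q = d₁.derivedPoint)
    (Wd₁ : WeierstrassCurve ℚ) [Wd₁.IsElliptic] [Wd₁.IsGloballyMinimal]
    (hWd₁ : ∃ C : VariableChange ℚ, C • W.quadraticTwist (NumberField.discr K₁ : ℚ) = Wd₁)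
    (hrd₁ : Wd₁.analyticRank = 1) (hSel₁ : Nat.card (Wd₁.selmerGroup 2) = 2)
    {q₀ q₁ : ℚ} (hq₀ : shaAn Wd₀ = (q₀ : ℂ)) (hq₁ : shaAn Wd₁ = (q₁ : ℂ)) :
    2 * (M₀ : ℤ) - 2 * (M₁ : ℤ) = padicValRat 2 q₀ - padicValRat 2 q₁ := by
  obtain ⟨qW, hqW, h₀⟩ := k4Neg_frameLedger_eq hGZ hGZK hL hMi W hr0 hρ hT hneg h4 Dt hc K₀ hIQ₀ hodd₀ h3₀ hHe₀ hsq1₀ ℓ₀ hℓ₀ hdK₀ h2K₀ β₀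
    ι₀ d₀ hy₀ hdiv₀ hndiv₀ Wd₀ hWd₀ hrd₀ hSel₀ hq₀
  obtain ⟨qW', hqW', h₁⟩ := k4Neg_frameLedger_eq hGZ hGZK hL hMi W hr0 hρ hT hneg h4 Dt hc K₁ hIQ₁ hodd₁ h3₁ hHe₁ hsq1₁ ℓ₁ hℓ₁ hdK₁ h2K₁
    β₁ ι₁ d₁ hy₁ hdiv₁ hndiv₁ Wd₁ hWd₁ hrd₁ hSel₁ hq₁
  have hqq : qW' = qW := Rat.cast_injective (α := ℂ) (hqW'.symm.trans hqW)
  rw [hqq] at h₁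
  linarith

/-- **LINE 32 «frame_rigidity⁻» STUB F2L⁻ `stub_twoFrameLedger` — VERBATIM** (pen bsd-idea-1 g26, `Cruxes/K4Neg/Lines/frame_rigidity.lean` v1.1): for
`E = W` on the K₄⁻ cell with an odd-Manin `Dt` and TWO admissible prime frames with Heegner data (exact depths `M₀`, `M₁ ≥ 1`) and their `Sel₂`-minimal
rank-one twins `Wd₀`, `Wd₁` (`ord₂ C(Wd_i) ≤ 1`) with `#Ш_an(Wd_i) = q_i ∈ ℚ`: **`2·M₀ − 2·M₁ = (ord₂ q₀ + ord₂ C(Wd₀)) − (ord₂ q₁ + ord₂ C(Wd₁))`**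
— the t-free form `k4Neg_twoFrameLedger_tFree` plus `ord₂ C(Wd₀) = ord₂ C(Wd₁) = 1` (prime `|d_K|`, `Δ < 0`, odd `C(E)`: the genus budget is one bit,
`PlusDescent.padicValNat_two_tamagawaProduct_twin_eq_one_of_prime`).  Pen: plug by name.  CONDITIONAL on the four print items; BSD / K4Neg NOT proved
— the line's open content is F1⁻ / F2T⁻ / F2Z⁻ / F4⁻. [cite: GrossZagier1986, V §2 (2.2)] [cite: Milne1972ArithmeticAV, §1 Thm. 1]
[cite: Kramer1981, Thm. 1, Prop. 7] [cite: Miller2011LMS, Def. 1.1] -/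
theorem k4Neg_twoFrameLedger (hGZ : GrossZagierAllLevels) (hGZK : MultPublishedInputsAtTwo) (hL : EntireLFunctionRat) (hMi : MilneAnyModel)
    (W : WeierstrassCurve ℚ) [W.IsElliptic] [W.IsGloballyMinimal] [NeZero (W.conductorNorm ℤ)]
    (_hcm : ¬ W.HasCM) (hr0 : W.analyticRank = 0) (hρ : ∀ n : ℕ, 0 < n → W.HasSurjectiveModNGaloisRep ((2 : ℤ) ^ n))
    (hT : Odd W.tamagawaProduct) (hneg : W.Δ < 0) (h4 : Nat.card (W.selmerGroup 2) = 4)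
    (Dt : ModularParametrizationData W (W.conductorNorm ℤ))
    (_hopt : ∀ z ∈ Dt.L.lattice, ∃ w ∈ periodLattice Dt.f, z = (Dt.c : ℂ) * w) (hc : Odd Dt.c)
    (K₀ : Type) [Field K₀] [NumberField K₀] (hIQ₀ : IsImaginaryQuadratic K₀) (hodd₀ : Odd (NumberField.discr K₀))
    (h3₀ : NumberField.discr K₀ ≠ -3) (hHe₀ : SatisfiesHeegnerHypothesis (W.conductorNorm ℤ) K₀)
    (hsq1₀ : ¬ IsSquare ((NumberField.discr K₀ : ℚ) * -|W.Δ|)) (_hsq2₀ : ¬ IsSquare ((NumberField.discr K₀ : ℚ) * (-(2 * |W.Δ|))))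
    (ℓ₀ : ℕ) (hℓ₀ : ℓ₀.Prime) (hdK₀ : NumberField.discr K₀ = -(ℓ₀ : ℤ))
    (h2K₀ : ((Ideal.span {(2 : ℤ)}).primesOver (𝓞 K₀)).ncard = 2)
    (β₀ : ℤ) (ι₀ : K₀ →+* ℂ) (d₀ : KolyvaginHeegnerData Dt β₀ ι₀ 1) (hy₀ : ¬ IsOfFinAddOrder d₀.derivedPoint)
    (M₀ : ℕ) (hdiv₀ : ∃ Q : (W.baseChange (ringClassField K₀ ι₀ 1)).toAffine.Point, ((2 ^ M₀ : ℕ) : ℤ) • Q = d₀.derivedPoint)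
    (hndiv₀ : ¬ ∃ Q : (W.baseChange (ringClassField K₀ ι₀ 1)).toAffine.Point, ((2 ^ (M₀ + 1) : ℕ) : ℤ) • Q = d₀.derivedPoint)
    (_hM₀ : 1 ≤ M₀)
    (Wd₀ : WeierstrassCurve ℚ) [Wd₀.IsElliptic] [Wd₀.IsGloballyMinimal]
    (hWd₀ : ∃ C : VariableChange ℚ, C • W.quadraticTwist (NumberField.discr K₀ : ℚ) = Wd₀)
    (hrd₀ : Wd₀.analyticRank = 1) (hSel₀ : Nat.card (Wd₀.selmerGroup 2) = 2) (_hDEF₀ : padicValNat 2 Wd₀.tamagawaProduct ≤ 1)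
    (K₁ : Type) [Field K₁] [NumberField K₁] (hIQ₁ : IsImaginaryQuadratic K₁) (hodd₁ : Odd (NumberField.discr K₁))
    (h3₁ : NumberField.discr K₁ ≠ -3) (hHe₁ : SatisfiesHeegnerHypothesis (W.conductorNorm ℤ) K₁)
    (hsq1₁ : ¬ IsSquare ((NumberField.discr K₁ : ℚ) * -|W.Δ|)) (_hsq2₁ : ¬ IsSquare ((NumberField.discr K₁ : ℚ) * (-(2 * |W.Δ|))))
    (ℓ₁ : ℕ) (hℓ₁ : ℓ₁.Prime) (hdK₁ : NumberField.discr K₁ = -(ℓ₁ : ℤ))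
    (h2K₁ : ((Ideal.span {(2 : ℤ)}).primesOver (𝓞 K₁)).ncard = 2)
    (β₁ : ℤ) (ι₁ : K₁ →+* ℂ) (d₁ : KolyvaginHeegnerData Dt β₁ ι₁ 1) (hy₁ : ¬ IsOfFinAddOrder d₁.derivedPoint)
    (M₁ : ℕ) (hdiv₁ : ∃ Q : (W.baseChange (ringClassField K₁ ι₁ 1)).toAffine.Point, ((2 ^ M₁ : ℕ) : ℤ) • Q = d₁.derivedPoint)
    (hndiv₁ : ¬ ∃ Q : (W.baseChange (ringClassField K₁ ι₁ 1)).toAffine.Point, ((2 ^ (M₁ + 1) : ℕ) : ℤ) • Q = d₁.derivedPoint)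
    (_hM₁ : 1 ≤ M₁)
    (Wd₁ : WeierstrassCurve ℚ) [Wd₁.IsElliptic] [Wd₁.IsGloballyMinimal]
    (hWd₁ : ∃ C : VariableChange ℚ, C • W.quadraticTwist (NumberField.discr K₁ : ℚ) = Wd₁)
    (hrd₁ : Wd₁.analyticRank = 1) (hSel₁ : Nat.card (Wd₁.selmerGroup 2) = 2) (_hDEF₁ : padicValNat 2 Wd₁.tamagawaProduct ≤ 1)
    (q₀ q₁ : ℚ) (hq₀ : shaAn Wd₀ = (q₀ : ℂ)) (hq₁ : shaAn Wd₁ = (q₁ : ℂ)) :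
    2 * (M₀ : ℤ) - 2 * (M₁ : ℤ) =
      (padicValRat 2 q₀ + (padicValNat 2 Wd₀.tamagawaProduct : ℤ)) - (padicValRat 2 q₁ + (padicValNat 2 Wd₁.tamagawaProduct : ℤ)) := by
  have h := k4Neg_twoFrameLedger_tFree hGZ hGZK hL hMi W hr0 hρ hT hneg h4 Dt hc K₀ hIQ₀ hodd₀ h3₀ hHe₀ hsq1₀ ℓ₀ hℓ₀ hdK₀ h2K₀ β₀ ι₀ d₀ hy₀
    hdiv₀ hndiv₀ Wd₀ hWd₀ hrd₀ hSel₀ K₁ hIQ₁ hodd₁ h3₁ hHe₁ hsq1₁ ℓ₁ hℓ₁ hdK₁ h2K₁ β₁ ι₁ d₁ hy₁ hdiv₁ hndiv₁ Wd₁ hWd₁ hrd₁ hSel₁ hq₀ hq₁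
  -- the genus budget of a prime frame is exactly one bit: `ord₂ C(Wd_i) = 1`
  have hprime₀ : (NumberField.discr K₀).natAbs.Prime := by rw [hdK₀, Int.natAbs_neg, Int.natAbs_natCast]; exact hℓ₀
  have hprime₁ : (NumberField.discr K₁).natAbs.Prime := by rw [hdK₁, Int.natAbs_neg, Int.natAbs_natCast]; exact hℓ₁
  obtain ⟨Cd₀, hCd₀⟩ := hWd₀
  obtain ⟨Cd₁, hCd₁⟩ := hWd₁
  have ht₀ : padicValNat 2 Wd₀.tamagawaProduct = 1 :=
    PlusDescent.padicValNat_two_tamagawaProduct_twin_eq_one_of_prime W hIQ₀ hodd₀ hHe₀ hT hneg hprime₀ Cd₀ hCd₀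
  have ht₁ : padicValNat 2 Wd₁.tamagawaProduct = 1 :=
    PlusDescent.padicValNat_two_tamagawaProduct_twin_eq_one_of_prime W hIQ₁ hodd₁ hHe₁ hT hneg hprime₁ Cd₁ hCd₁
  rw [ht₀, ht₁]
  push_cast
  linarith

end Summit.BirchSwinnertonDyer.BirchSwinnertonDyer.Theorems.GenusExact.ValuationLedger

end
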